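import Summits.ResolutionOfSingularities.ResolutionOfSingularities.Theorems.PurelyInseparableDim4PureLeafUnitDivergence
import Summits.ResolutionOfSingularities.ResolutionOfSingularities.Theorems.PurelyInseparableDim4ScopeBlindCoat
import HarnessLib

/-!
# The divergent MODE-1h branch of `…PureLeafUnitDivergence` is BLIND from its third state on
# (cell `res-dim4-pi`; K-second addendum K-P4-19 (R1)+(R2) of seat res-dim4-p-4 g3 to res-dim4-p-10 g3's brick (i))

[OURS · counted 0 · a statement about OUR coordinate-centre frame (`PIDim4.Step1h`, `PIDim4.InCoordinateScope`), not about
resolution.]  res-dim4-p-10 g3's `UnitDivergence.exists_step1h_chain_unitLeaf` (p692194) is an infinite MODE-1h branch over `𝔽₂` at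
`q = 2` from the `d = 0` leaf `x₀x₁x₂x₃(1 + x₀)`, whose tail runs through the family
`F m = x₁ · U_m`, `U_m = Σ_{t ≤ m} x₃^{t+1} + x₀ + x₀²x₃^m + x₀²x₃^{m+1}` (`UnitDivergence.step1h_F`), of total degree `m + 4`
(`UnitDivergence.totalDegree_F`).  This addendum records the SCOPE STATUS of that branch and puts divergence into the headline:

* §1 coefficient bookkeeping for `U_m` (def-free, `U_m` written out): `U_eq_sum`, `coeff_U_x0 = 1`, `coeff_U_x3 = 1`, `U_ne_zero`,
  `eval_zero_U = 0`, `aeval_kill_U` (`U_m` does not involve `x₁`), and `not_X_dvd_of_coeff` (a monomial with `dᵢ = 0` and non-zero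
  coefficient forbids `xᵢ ∣ P`);
* §2 **`not_inCoordinateScope_F (m) : ¬ InCoordinateScope 2 (F m)`** for EVERY `m` — `F m = x₁¹ · U_m` is a COAT in the sense of
  res-dim4-p-8 g3's `ScopeBlind.not_inCoordinateScope_coat` (`q = 2`, `k = x₁`: `Ū = U_m ≠ 0`, `Ū(0) = 0`, no `xᵢ ∣ Ū` because `x₀` and
  `x₃` are monomials of `U_m`); geometrically the `2`-fold locus of `z² + F m` contains the regular NON-coordinate surface
  `V(x₁, U_m)` through the origin (linear part of `U_m` is `x₀ + x₃`);
* §3 **`exists_divergent_blind_step1h_chain_unitLeaf`**: the chain of p-10's theorem, re-assembled from its own pieces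
  (`step1h_leaf`, `step1h_prefix`, `prefix_toState_eq`, `step_F`, `step1h_F`), with the two riders INSIDE the statement — from the
  third state on every state is OUT of coordinate scope and the `(k+2)`-nd `F` has total degree `≥ k + 4` (so the branch is non-periodic).

Reading for the boards: the branch is TIER-2 material from `k = 2` on (it leaves the coordinate scope at its third state and never
returns); it bears on MODE 1h / `Terminates1h 2 2` (refuted since K-A-01), NOT on F4-C (`TerminatesInScope 2 2` asks for in-scope
branches).  Nothing here proves or refutes F4-C(2,2) or resolution of singularities in dimension `≥ 4` / characteristic `p`;
counted 0; AI work, weaker than expert review.  bears_on: LADDER-RESOLUTION:D157-DOOR2 (res-dim4-pi · brick (i) scope rider).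
Supports stmt-ResolutionOfSingularities-16155 (helper).
-/

set_option linter.dupNamespace false

open MvPolynomial Finset

open scoped BigOperators

noncomputable section

namespace Summit.ResolutionOfSingularities.ResolutionOfSingularities.Theorems.PIDim4

namespace UnitDivergence

open Literature.AlgebraicGeometry.Resolution
open Literature.AlgebraicGeometry.Resolution.Hauser2010
open CentreBlowup StepKit

/-! ## §1 The cofactor `U_m` -/

/-- `U_m` as a sum of monomials. [folklore] -/
theorem U_eq_sum (m : ℕ) :
    ((∑ t ∈ Finset.range (m + 1), X 3 ^ (t + 1)) + X 0 + X 0 ^ 2 * X 3 ^ m + X 0 ^ 2 * X 3 ^ (m + 1) :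
        MvPolynomial (Fin 4) (ZMod 2)) =
      (∑ t ∈ Finset.range (m + 1), monomial (Finsupp.single 3 (t + 1)) 1) + monomial (Finsupp.single 0 1) 1 +
        monomial (Finsupp.single 0 2 + Finsupp.single 3 m) 1 + monomial (Finsupp.single 0 2 + Finsupp.single 3 (m + 1)) 1 := by
  simp only [X_pow_eq_monomial]
  simp only [X, monomial_mul, one_mul]

/-- The coefficient of `x₀` in `U_m` is `1`. [folklore] -/
theorem coeff_U_x0 (m : ℕ) :
    coeff (Finsupp.single 0 1)
      ((∑ t ∈ Finset.range (m + 1), X 3 ^ (t + 1)) + X 0 + X 0 ^ 2 * X 3 ^ m + X 0 ^ 2 * X 3 ^ (m + 1) :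
        MvPolynomial (Fin 4) (ZMod 2)) = 1 := by
  classical
  have hne1 : ∀ t, (Finsupp.single 3 (t + 1) : Fin 4 →₀ ℕ) ≠ Finsupp.single 0 1 :=
    fun t h => by have := DFunLike.congr_fun h 0; simp at this
  have hne2 : ∀ n, (Finsupp.single 0 2 + Finsupp.single 3 n : Fin 4 →₀ ℕ) ≠ Finsupp.single 0 1 :=
    fun n h => by have := DFunLike.congr_fun h 0; simp at this
  rw [U_eq_sum]
  simp only [coeff_add, coeff_sum, coeff_monomial, hne1, hne2, if_false, if_true, Finset.sum_const_zero, zero_add, add_zero]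

/-- The coefficient of `x₃` in `U_m` is `1`. [folklore] -/
theorem coeff_U_x3 (m : ℕ) :
    coeff (Finsupp.single 3 1)
      ((∑ t ∈ Finset.range (m + 1), X 3 ^ (t + 1)) + X 0 + X 0 ^ 2 * X 3 ^ m + X 0 ^ 2 * X 3 ^ (m + 1) :
        MvPolynomial (Fin 4) (ZMod 2)) = 1 := by
  classical
  have hne3 : ∀ t, ((Finsupp.single 3 (t + 1) : Fin 4 →₀ ℕ) = Finsupp.single 3 1) ↔ t = 0 :=
    fun t => ⟨fun h => by have := DFunLike.congr_fun h 3; simp at this; omega, fun h => by rw [h]⟩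
  have hne4 : (Finsupp.single 0 1 : Fin 4 →₀ ℕ) ≠ Finsupp.single 3 1 :=
    fun h => by have := DFunLike.congr_fun h 0; simp at this
  have hne5 : ∀ n, (Finsupp.single 0 2 + Finsupp.single 3 n : Fin 4 →₀ ℕ) ≠ Finsupp.single 3 1 :=
    fun n h => by have := DFunLike.congr_fun h 0; simp at this
  rw [U_eq_sum]
  simp only [coeff_add, coeff_sum, coeff_monomial, hne3, hne4, hne5, if_false, Finset.sum_ite_eq', Finset.mem_range,
    Nat.zero_lt_succ, if_true, add_zero]

/-- `U_m ≠ 0`. [folklore] -/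
theorem U_ne_zero (m : ℕ) :
    ((∑ t ∈ Finset.range (m + 1), X 3 ^ (t + 1)) + X 0 + X 0 ^ 2 * X 3 ^ m + X 0 ^ 2 * X 3 ^ (m + 1) :
        MvPolynomial (Fin 4) (ZMod 2)) ≠ 0 := fun h => by
  have h1 := coeff_U_x0 m
  rw [h, coeff_zero] at h1
  exact zero_ne_one h1

/-- `U_m(0) = 0`. [folklore] -/
theorem eval_zero_U (m : ℕ) :
    MvPolynomial.eval (0 : Fin 4 → ZMod 2)
      ((∑ t ∈ Finset.range (m + 1), X 3 ^ (t + 1)) + X 0 + X 0 ^ 2 * X 3 ^ m + X 0 ^ 2 * X 3 ^ (m + 1)) = 0 := by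
  simp

/-- `U_m` does not involve `x₁`: killing `x₁` leaves it unchanged. [folklore] -/
theorem aeval_kill_U (m : ℕ) :
    MvPolynomial.aeval (R := ZMod 2) (fun i : Fin 4 => if i = 1 then (0 : MvPolynomial (Fin 4) (ZMod 2)) else X i)
      ((∑ t ∈ Finset.range (m + 1), X 3 ^ (t + 1)) + X 0 + X 0 ^ 2 * X 3 ^ m + X 0 ^ 2 * X 3 ^ (m + 1)) =
      (∑ t ∈ Finset.range (m + 1), X 3 ^ (t + 1)) + X 0 + X 0 ^ 2 * X 3 ^ m + X 0 ^ 2 * X 3 ^ (m + 1) := by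
  simp only [map_add, map_sum, map_mul, map_pow, aeval_X, show ((0 : Fin 4) = 1) = False from by decide,
    show ((3 : Fin 4) = 1) = False from by decide, if_false]

/-- A monomial `x^d` with `dᵢ = 0` and non-zero coefficient in `P` forbids `xᵢ ∣ P`. [folklore] -/
theorem not_X_dvd_of_coeff {K : Type} [Field K] {i : Fin 4} {d : Fin 4 →₀ ℕ} {P : MvPolynomial (Fin 4) K}
    (hd : d i = 0) (hc : coeff d P ≠ 0) : ¬ ((X i : MvPolynomial (Fin 4) K) ∣ P) := by
  classical
  rintro ⟨Q, rfl⟩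
  rw [coeff_X_mul'] at hc
  have hi : i ∉ d.support := by simp [Finsupp.mem_support_iff, hd]
  rw [if_neg hi] at hc
  exact hc rfl

/-! ## §2 Every `F m` is out of coordinate scope -/

/-- **`F m = x₁ · U_m` is OUT of coordinate scope for every `m`** (a coat: the regular non-coordinate surface `V(x₁, U_m)` lies in
the `2`-fold locus of `z² + F m`). [folklore] -/
theorem not_inCoordinateScope_F (m : ℕ) :
    ¬ InCoordinateScope 2
      (X 1 * ((∑ t ∈ Finset.range (m + 1), X 3 ^ (t + 1)) + X 0 + X 0 ^ 2 * X 3 ^ m + X 0 ^ 2 * X 3 ^ (m + 1)) :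
        MvPolynomial (Fin 4) (ZMod 2)) := by
  have h := ScopeBlind.not_inCoordinateScope_coat (K := ZMod 2) (q := 2) le_rfl 1
    ((∑ t ∈ Finset.range (m + 1), X 3 ^ (t + 1)) + X 0 + X 0 ^ 2 * X 3 ^ m + X 0 ^ 2 * X 3 ^ (m + 1)) ?_ ?_ ?_
  · rwa [show (2 - 1 : ℕ) = 1 from rfl, pow_one] at h
  · rw [aeval_kill_U]; exact U_ne_zero m
  · exact eval_zero_U m
  · intro i hi
    rw [aeval_kill_U]
    have hx0 := coeff_U_x0 m
    have hx3 := coeff_U_x3 m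
    fin_cases i
    · exact not_X_dvd_of_coeff (d := Finsupp.single 3 1) (by simp) (by rw [hx3]; exact one_ne_zero)
    · exact absurd rfl hi
    · exact not_X_dvd_of_coeff (d := Finsupp.single 0 1) (by simp) (by rw [hx0]; exact one_ne_zero)
    · exact not_X_dvd_of_coeff (d := Finsupp.single 0 1) (by simp) (by rw [hx0]; exact one_ne_zero)

/-! ## §3 The headline with both riders inside -/

/-- **A DIVERGENT, EVENTUALLY BLIND MODE-1h BRANCH FROM THE `d = 0` LEAF `x₀x₁x₂x₃(1 + x₀)` OVER `𝔽₂`** — p-10 g3's chain with the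
scope and degree riders in the statement: from the third state on every state is OUT of coordinate scope and the `F`-components have
total degree `≥ k + 4`, unbounded. [OURS · counted 0] [folklore] -/
theorem exists_divergent_blind_step1h_chain_unitLeaf :
    ∃ c : ℕ → State (ZMod 2),
      c 0 = (⟨[(![1, 1, 1, 1], 1), (![2, 1, 1, 1], 1)], ![0, 0, 0, 0], ∅⟩ : SData 4 (ZMod 2)).toState ∧
        (∀ k, Step1h 2 (c k) (c (k + 1))) ∧
          ∀ k, ¬ InCoordinateScope 2 (c (k + 2)).F ∧ k + 4 ≤ (c (k + 2)).F.totalDegree := by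
  -- the tail: iterate the family step from `⟨F 0, 0, {2}⟩` (verbatim the construction of `exists_step1h_chain_unitLeaf`)
  let tail : ℕ → State (ZMod 2) := fun k => Nat.rec
    (⟨X 1 * ((∑ t ∈ Finset.range (0 + 1), X 3 ^ (t + 1)) + X 0 + X 0 ^ 2 * X 3 ^ 0 + X 0 ^ 2 * X 3 ^ (0 + 1)), 0, {2}⟩ : State (ZMod 2))
    (fun _ s => step 2 ({0, 1, 3} : Finset (Fin 4)) 3 (fun i => if i = 0 then 1 else 0) s) k
  have htail : ∀ k, ∃ exc : Finset (Fin 4), tail k =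
      ⟨X 1 * ((∑ t ∈ Finset.range (k + 1), X 3 ^ (t + 1)) + X 0 + X 0 ^ 2 * X 3 ^ k + X 0 ^ 2 * X 3 ^ (k + 1)), 0, exc⟩ := by
    intro k
    induction k with
    | zero => exact ⟨{2}, rfl⟩
    | succ k ih =>
      obtain ⟨exc, hk⟩ := ih
      refine ⟨insert 3 (exc.filter fun i => (if i = (0 : Fin 4) then (1 : ZMod 2) else 0) = 0), ?_⟩
      show step 2 ({0, 1, 3} : Finset (Fin 4)) 3 (fun i => if i = 0 then 1 else 0) (tail k) = _
      rw [hk, step_F]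
  refine ⟨fun k => if k = 0 then (⟨[(![1, 1, 1, 1], 1), (![2, 1, 1, 1], 1)], ![0, 0, 0, 0], ∅⟩ : SData 4 (ZMod 2)).toState
      else if k = 1 then (⟨[(![1, 1, 1, 0], 1), (![2, 1, 1, 1], 1)], ![0, 0, 0, 0], {3}⟩ : SData 4 (ZMod 2)).toState
      else tail (k - 2), by simp, fun k => ?_, fun k => ?_⟩
  · rcases k with _ | _ | k
    · simpa using step1h_leaf
    · simp only [zero_add, one_ne_zero, if_false, if_true, show (1 + 1 : ℕ) = 2 from rfl, show ((2 : ℕ) = 0) = False from by decide,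
        show ((2 : ℕ) = 1) = False from by decide, Nat.sub_self]
      have h := step1h_prefix
      rw [prefix_toState_eq] at h
      exact h
    · simp only [show (k + 1 + 1 = 0) = False from by simp, show (k + 1 + 1 = 1) = False from by simp,
        show (k + 1 + 1 + 1 = 0) = False from by simp, show (k + 1 + 1 + 1 = 1) = False from by simp, if_false,
        show k + 1 + 1 - 2 = k from by omega, show k + 1 + 1 + 1 - 2 = k + 1 from by omega]
      obtain ⟨exc, hk⟩ := htail k
      have hsucc : tail (k + 1) = step 2 ({0, 1, 3} : Finset (Fin 4)) 3 (fun i => if i = 0 then 1 else 0) (tail k) := rfl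
      rw [hsucc, hk, step_F]
      exact step1h_F k exc
  · simp only [show (k + 2 = 0) = False from by simp, show (k + 2 = 1) = False from by simp, if_false,
      show k + 2 - 2 = k from by omega]
    obtain ⟨exc, hk⟩ := htail k
    rw [hk]
    exact ⟨not_inCoordinateScope_F k, totalDegree_F k⟩

end UnitDivergence

end Summit.ResolutionOfSingularities.ResolutionOfSingularities.Theorems.PIDim4

end
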